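import Mathlib
import HarnessLib
import HarnessLib.Audit
import Summits.SmoothPoincare4.Statement
import Literature.Topology.FourManifolds.ConnectedSum
import Literature.Topology.FourManifolds.ComplexProjectiveSpace
import Literature.Topology.FourManifolds.HomotopyS4OrientableProofs

/-!
Route: RootDecompN

DORMANT since 2026-09-04T16:53:01Z (reconciler: no traction for 5.1 d (last activity item-proof-filed at 2026-08-30T15:03:03Z); parked, not closed — `ledger route dormant route-SmoothPoincare4-RootDecompN --off` to reactivate) — unstaffed, not closed; items shared with open routes are served there. `ledger route dormant <id> --off` reactivates.

# Route RootDecompN — Root decomposition N (ChiralCarving, lens 6, gen 4) — SPC4 iff definite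
dissolution, chiral upgrade (one sign ⟹ both; attacked), ℂℙ²-cancellation at rank one (pooled),
bi-definite descent (residual)

ROOT DECOMPOSITION NODE N of cell decomp-sp4 (D-0178, LADDER-SmoothPoincare4 rung 0; lens 6 =
barrier-complement carving, generation 4; node
ChiralCarving; adopted by the route-writer as a NEW OR-sibling root route RootDecompN — route B is
NOT edited). TARGET = the ROOT `_root_.SmoothPoincare4`
verbatim ⟸ DefiniteDissolution (E = stmt-SmoothPoincare4-24779 VERBATIM, POOLED with RootDecompB;
B's attacked piece) ∧ ChiralUpgrade (CU, NEW, the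
ATTACKED piece of this node) ∧ CP2CancellationOne (X₁ = stmt-SmoothPoincare4-17708 VERBATIM, POOLED
with RootDecompB / DissolvableGluck) ∧ BiDefiniteDescent
(DD±, NEW, DECLARED RESIDUAL). It suffices to show X = E ∧ CU ∧ X₁ ∧ DD± where, for a smooth
homotopy 4-sphere M: (E) M dissolves along SOME coherently
oriented one-chirality blow-up chain — M # nℂℙ² ≅ #nℂℙ² for ONE sign and some n (B's DefiniteChain
matrix verbatim: P Q : ℕ → Type with per-index
instances, P 0 ≅ M, IsOrientedConnectedSum (o i) (c i) (o (i+1)) with a constant chirality c i = c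
j, the S⁴-side chain Q from S⁴, P n ≅ Q n);
(CU) CHIRAL UPGRADE — if M dissolves along one such chain then for EVERY orientation oM of M and
EVERY chirality c₀ of ℂℙ² there is a PINNED chain
(P' 0 ≅ M orientation-PRESERVING for (o' 0, oM), every step an oriented connected sum with (ℂℙ²,
c₀), Q' 0 ≅ S⁴, P' m ≅ Q' m): «dissolvable in one
chirality ⟹ dissolvable in both»; (X₁) ℂℙ²-CANCELLATION AT RANK ONE, orientation-free: M # ℂℙ² ≅ ℂℙ²
⟹ M ≅ S⁴; (DD±) BI-DEFINITE DESCENT — if for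
every (oM, c₀) there is a pinned chain of POSITIVE length then some M # ℂℙ² ≅ ℂℙ² (rank one). The
carving is EXACT in kernel (lens certificate
`Split3.smoothPoincare4_iff_chiralCarving : S ⟺ E ∧ CU ∧ X₁ ∧ DD±`, each piece NECESSARY
`*_of_spc4`), and it REFINES route B: B's residual
R = DefiniteCancellation #24778 ⟺ CU ∧ X₁ ∧ DD± (`definiteCancellation_iff_split3`), B's layer-2
residual child DD #26487 ⟹ DD±
(`biDefiniteDescent_of_definiteDescent`) — so mod X₁ the old residual DD ≡ R ≡ CU ∧ DD± and this
node splits it further along the CHIRALITY axis.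
`closes : E → CU → X₁ → DD± → S` is pure logic (by_contra: if M ≇ S⁴ every pinned chain has positive
length ⇒ DD± ⇒ rank one ⇒ X₁). Idea-card link:
none existing (new mechanism for the cell). SmoothPoincare4 is NOT proved by anything here: all four
pieces are open statements implied by S (kernel),
their conjunction gives S by `closes` (4/4 binders consumed); for tribunal scoring (critic RESIDUAL
CALL, CLEARED 2026-08-30T04:44:38Z): residual =
[BiDefiniteDescent], attacked = [ChiralUpgrade] (GENUINE-P3: decided TRUE on the Gluck family Φ2 in
both signs and on every amphichiral Σ ⊇ all doubles
D(P) = Φ4, kernel) together with the pooled E (B's attack), pooled summit-grade debt =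
[CP2CancellationOne] (counted once per summit, DissolvableGluck).
Lean: `(open scoped ContDiff in ∀ (M : Type) [TopologicalSpace M] [T2Space M]
[SecondCountableTopology M] [ChartedSpace (EuclideanSpace ℝ (Fin 4)) M] [IsManifold (𝓡 4) ∞ M],
Nonempty (ContinuousMap.HomotopyEquiv M (Metric.sphere (0 : EuclideanSpace ℝ (Fin 5)) 1)) → ∃ (n :
ℕ) (P Q : ℕ → Type) (_ : ∀ i, TopologicalSpace (P i)) (_ : ∀ i, T2Space (P i)) (_ : ∀ i,
SecondCountableTopology (P i)) (_ : ∀ i, ChartedSpace (EuclideanSpace ℝ (Fin 4)) (P i)) (_ : ∀ i,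
IsManifold (𝓡 4) ∞ (P i)) (_ : ∀ i, CompactSpace (P i)) (_ : ∀ i, TopologicalSpace (Q i)) (_ : ∀ i,
T2Space (Q i)) (_ : ∀ i, SecondCountableTopology (Q i)) (_ : ∀ i, ChartedSpace (EuclideanSpace ℝ
(Fin 4)) (Q i)) (_ : ∀ i, IsManifold (𝓡 4) ∞ (Q i)) (_ : ∀ i, CompactSpace (Q i)) (o : ∀ i,
Literature.Topology.FourManifolds.SmoothOrientation (𝓡 4) (P i)) (c : ∀ i, i < n →
Literature.Topology.FourManifolds.SmoothOrientation (𝓡 4)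
Literature.Topology.FourManifolds.ComplexProjectivePlane), Nonempty (P 0 ≃ₘ⟮𝓡 4, 𝓡 4⟯ M) ∧ Nonempty
(Q 0 ≃ₘ⟮𝓡 4, 𝓡 4⟯ (Metric.sphere (0 : EuclideanSpace ℝ (Fin 5)) 1)) ∧ (∀ i (hi : i < n),
Literature.Topology.FourManifolds.IsOrientedConnectedSum (o i) (c i hi) (o (i + 1))) ∧ (∀ i j (hi :
i < n) (hj : j < n), c i hi = c j hj) ∧ (∀ i < n, Literature.Topology.FourManifolds.IsConnectedSum
(𝓡 4) (𝓡 4) (𝓡 4) (Q i) Literature.Topology.FourManifolds.ComplexProjectivePlane (Q (i + 1))) ∧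
Nonempty (P n ≃ₘ⟮𝓡 4, 𝓡 4⟯ Q n)) ∧ (open scoped ContDiff in ∀ (M : Type) [TopologicalSpace M]
[T2Space M] [SecondCountableTopology M] [ChartedSpace (EuclideanSpace ℝ (Fin 4)) M] [IsManifold (𝓡
4) ∞ M], Nonempty (ContinuousMap.HomotopyEquiv M (Metric.sphere (0 : EuclideanSpace ℝ (Fin 5)) 1)) →
∀ (n : ℕ) (P Q : ℕ → Type) [∀ i, TopologicalSpace (P i)] [∀ i, T2Space (P i)] [∀ i,
SecondCountableTopology (P i)] [∀ i, ChartedSpace (EuclideanSpace ℝ (Fin 4)) (P i)] [∀ i, IsManifold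
(𝓡 4) ∞ (P i)] [∀ i, CompactSpace (P i)] [∀ i, TopologicalSpace (Q i)] [∀ i, T2Space (Q i)] [∀ i,
SecondCountableTopology (Q i)] [∀ i, ChartedSpace (EuclideanSpace ℝ (Fin 4)) (Q i)] [∀ i, IsManifold
(𝓡 4) ∞ (Q i)] [∀ i, CompactSpace (Q i)] (o : ∀ i,
Literature.Topology.FourManifolds.SmoothOrientation (𝓡 4) (P i)) (c : ∀ i, i < n →
Literature.Topology.FourManifolds.SmoothOrientation (𝓡 4)
Literature.Topology.FourManifolds.ComplexProjectivePlane), Nonempty (P 0 ≃ₘ⟮𝓡 4, 𝓡 4⟯ M) → Nonempty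
(Q 0 ≃ₘ⟮𝓡 4, 𝓡 4⟯ (Metric.sphere (0 : EuclideanSpace ℝ (Fin 5)) 1)) → (∀ i (hi : i < n),
Literature.Topology.FourManifolds.IsOrientedConnectedSum (o i) (c i hi) (o (i + 1))) → (∀ i j (hi :
i < n) (hj : j < n), c i hi = c j hj) → (∀ i < n, Literature.Topology.FourManifolds.IsConnectedSum
(𝓡 4) (𝓡 4) (𝓡 4) (Q i) Literature.Topology.FourManifolds.ComplexProjectivePlane (Q (i + 1))) →
Nonempty (P n ≃ₘ⟮𝓡 4, 𝓡 4⟯ Q n) → ∀ (oM : Literature.Topology.FourManifolds.SmoothOrientation (𝓡 4)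
M) (c₀ : Literature.Topology.FourManifolds.SmoothOrientation (𝓡 4)
Literature.Topology.FourManifolds.ComplexProjectivePlane), ∃ (m : ℕ) (P' Q' : ℕ → Type) (_ : ∀ i,
TopologicalSpace (P' i)) (_ : ∀ i, T2Space (P' i)) (_ : ∀ i, SecondCountableTopology (P' i)) (_ : ∀
i, ChartedSpace (EuclideanSpace ℝ (Fin 4)) (P' i)) (_ : ∀ i, IsManifold (𝓡 4) ∞ (P' i)) (_ : ∀ i,
CompactSpace (P' i)) (_ : ∀ i, TopologicalSpace (Q' i)) (_ : ∀ i, T2Space (Q' i)) (_ : ∀ i,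
SecondCountableTopology (Q' i)) (_ : ∀ i, ChartedSpace (EuclideanSpace ℝ (Fin 4)) (Q' i)) (_ : ∀ i,
IsManifold (𝓡 4) ∞ (Q' i)) (_ : ∀ i, CompactSpace (Q' i)) (o' : ∀ i,
Literature.Topology.FourManifolds.SmoothOrientation (𝓡 4) (P' i)), (∃ e : P' 0 ≃ₘ⟮𝓡 4, 𝓡 4⟯ M,
e.IsOrientationPreserving (o' 0) oM) ∧ Nonempty (Q' 0 ≃ₘ⟮𝓡 4, 𝓡 4⟯ (Metric.sphere (0 :
EuclideanSpace ℝ (Fin 5)) 1)) ∧ (∀ i < m, Literature.Topology.FourManifolds.IsOrientedConnectedSum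
(o' i) c₀ (o' (i + 1))) ∧ (∀ i < m, Literature.Topology.FourManifolds.IsConnectedSum (𝓡 4) (𝓡 4) (𝓡
4) (Q' i) Literature.Topology.FourManifolds.ComplexProjectivePlane (Q' (i + 1))) ∧ Nonempty (P' m
≃ₘ⟮𝓡 4, 𝓡 4⟯ Q' m)) ∧ (open scoped ContDiff in ∀ (M : Type) [TopologicalSpace M] [T2Space M]
[SecondCountableTopology M] [ChartedSpace (EuclideanSpace ℝ (Fin 4)) M] [IsManifold (𝓡 4) ∞ M],
ContinuousMap.HomotopyEquiv M (Metric.sphere (0 : EuclideanSpace ℝ (Fin 5)) 1) → (∃ (P : Type) (_ :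
TopologicalSpace P) (_ : T2Space P) (_ : SecondCountableTopology P) (_ : ChartedSpace
(EuclideanSpace ℝ (Fin 4)) P) (_ : IsManifold (𝓡 4) ∞ P),
Literature.Topology.FourManifolds.IsConnectedSum (𝓡 4) (𝓡 4) (𝓡 4) M
Literature.Topology.FourManifolds.ComplexProjectivePlane P ∧ Nonempty (P ≃ₘ⟮𝓡 4, 𝓡 4⟯
Literature.Topology.FourManifolds.ComplexProjectivePlane)) → Nonempty (M ≃ₘ⟮𝓡 4, 𝓡 4⟯ Metric.sphere
(0 : EuclideanSpace ℝ (Fin 5)) 1)) ∧ (open scoped ContDiff in ∀ (M : Type) [TopologicalSpace M]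
[T2Space M] [SecondCountableTopology M] [ChartedSpace (EuclideanSpace ℝ (Fin 4)) M] [IsManifold (𝓡
4) ∞ M], Nonempty (ContinuousMap.HomotopyEquiv M (Metric.sphere (0 : EuclideanSpace ℝ (Fin 5)) 1)) →
(∀ (oM : Literature.Topology.FourManifolds.SmoothOrientation (𝓡 4) M) (c₀ :
Literature.Topology.FourManifolds.SmoothOrientation (𝓡 4)
Literature.Topology.FourManifolds.ComplexProjectivePlane), ∃ (n : ℕ) (P Q : ℕ → Type) (_ : ∀ i,
TopologicalSpace (P i)) (_ : ∀ i, T2Space (P i)) (_ : ∀ i, SecondCountableTopology (P i)) (_ : ∀ i,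
ChartedSpace (EuclideanSpace ℝ (Fin 4)) (P i)) (_ : ∀ i, IsManifold (𝓡 4) ∞ (P i)) (_ : ∀ i,
CompactSpace (P i)) (_ : ∀ i, TopologicalSpace (Q i)) (_ : ∀ i, T2Space (Q i)) (_ : ∀ i,
SecondCountableTopology (Q i)) (_ : ∀ i, ChartedSpace (EuclideanSpace ℝ (Fin 4)) (Q i)) (_ : ∀ i,
IsManifold (𝓡 4) ∞ (Q i)) (_ : ∀ i, CompactSpace (Q i)) (o : ∀ i,
Literature.Topology.FourManifolds.SmoothOrientation (𝓡 4) (P i)), 0 < n ∧ (∃ e : P 0 ≃ₘ⟮𝓡 4, 𝓡 4⟯ M,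
e.IsOrientationPreserving (o 0) oM) ∧ Nonempty (Q 0 ≃ₘ⟮𝓡 4, 𝓡 4⟯ (Metric.sphere (0 : EuclideanSpace
ℝ (Fin 5)) 1)) ∧ (∀ i < n, Literature.Topology.FourManifolds.IsOrientedConnectedSum (o i) c₀ (o (i +
1))) ∧ (∀ i < n, Literature.Topology.FourManifolds.IsConnectedSum (𝓡 4) (𝓡 4) (𝓡 4) (Q i)
Literature.Topology.FourManifolds.ComplexProjectivePlane (Q (i + 1))) ∧ Nonempty (P n ≃ₘ⟮𝓡 4, 𝓡 4⟯ Q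
n)) → ∃ (P' : Type) (_ : TopologicalSpace P') (_ : T2Space P') (_ : SecondCountableTopology P') (_ :
ChartedSpace (EuclideanSpace ℝ (Fin 4)) P') (_ : IsManifold (𝓡 4) ∞ P'),
Literature.Topology.FourManifolds.IsConnectedSum (𝓡 4) (𝓡 4) (𝓡 4) M
Literature.Topology.FourManifolds.ComplexProjectivePlane P' ∧ Nonempty (P' ≃ₘ⟮𝓡 4, 𝓡 4⟯
Literature.Topology.FourManifolds.ComplexProjectivePlane))`

## Assembly
The deciding theorem is glue.lean `closes : DefiniteDissolution → ChiralUpgrade → CP2CancellationOne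
→ BiDefiniteDescent → SmoothPoincare4` (pure logic,
= the lens’s split/glue_root.lean / node `closes` / certificate `Split3.closesChiral`: fix M ≃ₕ S⁴;
by contradiction M ≇ S⁴; take E’s one-sign chain; CU
pins it for every (oM, c₀); a pinned chain of length 0 would give M ≅ P′0 ≅ Q′0 ≅ S⁴, so every
pinned chain has positive length; DD± gives rank one; X₁
concludes). The Assembly item records the same implication as a Prop.

Rationale: WHY THIS LINE. Mechanism (lens 6, barrier-complement carving; axis = CHIRALITY). Generations 0–3 of
this lens carved the definite programme along RANK (B: E ∧ R;
R ⟸ X₁ ∧ DD) and certified the MIXED-chirality axis as COSTUME (v3 WallQuadrant, critic ruling R8).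
Generation 4 carves B's residual along the one axis the
Khovanov-type barrier itself names: the FGMW/Rasmussen-s strategy and its gl₂ skein-lasagna
refinement are blind exactly on homotopy spheres that dissolve in
BOTH signs (MMSW arXiv:1910.08195 §9.3, remark after Q9.11 [corpus:paper:arxiv-1910.08195 p30:L25]
«the same result would hold for any homotopy 4-sphere X
satisfying X # (#ʳℂℙ²) = #ʳℂℙ² and X # (#ʳℂℙ²bar) = #ʳℂℙ²bar for some r» = E± exactly; Question 9.12
[p30:L29] asks E± for every double D(P); Ren–Willis 2024
Prop. 6.17 / §6.10), while E gives only ONE sign. CU is the precisely typed statement «the barrier's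
complement inside E's population is empty» — and unlike
R it is decidable family by family with S open: TRUE on every Gluck twist in both signs (Gluck 1962
§8 reflection; Akbulut–Yasui arXiv:1205.6038 Cor. 1.3;
tree fact Literature.Barriers.SmoothPoincare4.gluckTwist_connectedSum_complexProjectivePlane,
relational over all discs ⇒ both signs; kernel
`chiralUpgrade_on_gluckTwists` mod the two named tree facts whose proof modules are farm-unbuilt)
and TRUE on every AMPHICHIRAL homotopy sphere (kernel,
unconditional `chiralUpgrade_on_amphichiral`: orientation dichotomy of P 0 ≅ M + mirror (o, c₀) ↦
(−o, −c₀) + transport along an orientation-reversing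
self-diffeomorphism) — which contains ALL DOUBLES D(P) of balanced presentations (Φ4, MMSW Q9.12's
family) and all Σ # −Σ; hence on Φ4, Q9.12 ⟺ E|Φ4
(kernel `biDefiniteDissolution_iff_and`: E ∧ CU ⟺ E±). Imported from elsewhere: nothing beyond Kirby
calculus of blow-ups (Gompf–Stipsicz §2.4, Ex. 5.2.7(b);
Gompf 1991 doi:10.1016/0040-9383(91)90036-4) and the SW blow-up formula as the reason dissolution IS
chiral at b⁺ ≥ 1 (Fintushel–Stern 1995) — the bet is that
the asymmetry dies on homotopy spheres, where no gauge invariant survives a blow-up. What the line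
does that prior routes do not: routes A (MirrorDichotomy,
INVERTIBILITY #0373), C (MirrorCancellation #24934: Σ # −Σ-type cancellation), G/L (Gluck
localisation) concern the mirror of Σ, not the SIGN of the blow-up;
B/DissolvableGluck fix one sign; CU quantifies over (oM, c₀) jointly and is insensitive to Σ ↦ −Σ
(kernel `biChain_neg_iff`). Negatives index: empty for this
summit (0 refuted statements at filing). Workshop record (writer decomp-sp4-writer-1 g2, cell
decomp-sp4, rung 0, D-0178): node ChiralCarving of lens 6 (barrier-complement carving), generation 4
(NODE 2026-08-30T04:36:41Z HOME/STATUS.md line 176; RESULT line 177); node file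
decomp-sp4-lens-6/v4/ChiralCarving.lean sha256
eab90e5b831a5bfc7d6368e76f654dc574aa5f7b2046816469e2372ae90c088c (standalone, own namespace, rc 0 ·
0 sorry · 0 errors · axioms(closes) = [propext, Classical.choice, Quot.sound]); CERTIFICATE
decomp-sp4-lens-6/v4/split/RootDecompBSplit3.lean sha256
63bbd67fa65606d907ed11118076fbbc11cb3bfa214121d39bdd525750a5f8cb (the same content re-based on the
BORN modules Theses.RootDecompB + Theses.DissolvableGluck so E / R / X₁ / DD ARE the tree decls:
glue `Split3.definiteCancellation_of_split3 : CU → X₁ → DD± → R`, exactness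
`definiteCancellation_iff_split3 : R ⟺ CU ∧ X₁ ∧ DD±`, refined carving
`smoothPoincare4_iff_chiralCarving : S ⟺ E ∧ CU ∧ X₁ ∧ DD±`, `closesChiral`, necessity ×4
`*_of_spc4`, dominations `chiralUpgrade_of_definiteCancellation`,
`biDefiniteDescent_of_definiteDescent` (DD ⟹ DD±), `chiralUpgrade_of_cp2Rigid`, `cp2Rigid_of_spc4`,
`biDefiniteDissolution_iff_and` (E ∧ CU ⟺ E±), rungs `chiralUpgrade_on_gluckTwists`,
`chiralUpgrade_on_amphichiral` (unconditional), `biDefiniteDescent_on_gluckTwists`, B’s pending glue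
#26488 as a theorem text `definiteCancellation_of_one_descent`; rc 0 · 0 sorry · axioms std; critic
re-ran it as l6v4/SplitCheck.lean + rfl identities); split/SigCheck.lean sha256
783242c81973a536355176dba9bac5d3240f56292cb1f76af85a22e4194a2f5a (the NEW bodies one-line in the
born namespace, rc 0); split/children.json sha256
f484a00c1bb4bba876899b2f755e763a88eee0e191e156714b3d97618335b874 (bodies VERBATIM = this route’s
Lean lines; X₁ byte-identical to the tree body, writer re-check True; E taken VERBATIM from the tree
file Theses/RootDecompB.lean rev 1); split/glue_root.lean sha256
f87172b8c7c3a8b408000062714df94e059d735a6da3d2a65886ea35137ba4e4 = this route’s `closes` (4 binders,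
all load-bearing: probes P7/P8; the writer changed only the conclusion spelling
`_root_.SmoothPoincare4` ↦ `SmoothPoincare4` if needed by the renderer and dropped the comment
header); NODE.md sha256 53afa7e837304e8b1e3b234e7b93eeafdd90c6d498c0373de04f756cbde4f59a; EDIT.md /
GlueLandings.md in the package. WHY AN OR-SIBLING (not the critic-preferred W2 resplit of B): the
writer ran `ledger --json route edit route-SmoothPoincare4-RootDecompB --resplit
DefiniteCancellation --into children.w.json …` and the gate answered «resplit: only the route’s
tenure planner (lease unit = this route) or the operator» (l6v4/edit.out, rc 1, nothing recorded);
nesting under DD would be a third layer; the critic CLEARED the OR-sibling alternative explicitly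
(«OR-sibling acceptable (this node HAS its own attacked piece)», line 188) and the lens shipped
glue_root.lean for it. The operator may still run the prepared resplit on B (children file + command
in the writer folder) and then close this route superseded-by B rev 2 — ASK filed. B rev 1 (E ∧ R; R
⟸ X₁ ∧ DD, glue #26488) is untouched; E #24779 and X₁ #17708 are POOLED here by signature; DD #26487
stays B’s child of record and `DD → DD±` (GlueLandings §3) is to be landed `--supports` the DD±
item. Census: HOME/census/COSTUME-CENSUS-v4.md sha256
060ea95f1f136eee90e63ed1dafc51bf5855ef6b21b08b32da5b5398b5816ec8. Lattice rows for TREE.md (kernel):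
S ⟺ E ∧ CU ∧ X₁ ∧ DD±; R #24778 ⟺ CU ∧ X₁ ∧ DD±; E ∧ CU ⟺ E± (= MMSW Q9.12 hypothesis); CP2Rigid ⟹
CU, E±, DissolveOne; DD #26487 ⟹ DD±. Prover W-items (GlueLandings.md): §1 land B’s glue #26488
(text kernel-checked); §3 `DD → DD±` --supports <DD± item>, `R → CU` --supports <CU item>,
`DissolveOne #17710 → E #24779`. Nothing here proves SmoothPoincare4 (rung 0). Critic verdict:
CLEARED decomp-sp4-crit-1 g2 2026-08-30T04:44:38Z (HOME/STATUS.md line 188 «CLEARED … NODE lens-6 g4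
ChiralCarving (3-way RESPLIT of B's residual R = DefiniteCancellation #24778 along the CHIRALITY
axis: R ⟺ ChiralUpgrade (NEW, attacked) ∧ CP2CancellationOne
(#17708 pooled) ∧ BiDefiniteDescent (NEW, declared residual); E #24779 pooled) — CLEARED, W2
(resplit of B) preferred, OR-sibling acceptable (this node HAS its
own attacked piece), W1 (land #26488) endorsed. MY CHECKS: l6v4/SplitCheck.lean = lens cert
split/RootDecompBSplit3.lean (63bbd67f…) + CritSigL6 (the three
children.json statements pasted as defs) + CritL6G4: CritSigL6.ChiralUpgrade =
RootDecompB.Split3.ChiralUpgrade := rfl, CritSigL6.BiDefiniteDescent =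
RootDecompB.Split3.BiDefiniteDescent := rfl, CritSigL6.CP2CancellationOne =
RootDecompB.CP2CancellationOne := rfl and = DissolvableGluck.CP2CancellationOne := rfl
(#17708 byte-identical ✓); glueProbe CU → RootDecompB.CP2CancellationOne → DD± →
RootDecompB.DefiniteCancellation; exactProbe; ddProbe RootDecompB.DefiniteDescent
(#26487) → DD±; glue26488; closesProbe = RootDecompB.closes h₁ (definiteCancellation_of_split3 h₂ h₃
h₄); necessity cuNec/ddNec from ROOT — rc0 · 0 sorry · 0
errors · axioms(CritL6G4.closesProbe) = {propext, Classical.choice, Quot.sound}; node file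
ChiralCarving.lean (eab90e5b…) rc0 · 0 sorry · axioms(closes) std.
TYPING vs ROOT: frames = ROOT's bare binders; chains = B's DefiniteChain matrix verbatim; NEW in
CU/DD±: the PINNED chain — the correct typing of «one chirality
w.r.t. a fixed orientation of M» (kernel biChain_neg_iff); R7: length-0 chains are allowed and MEAN
M ≅ S⁴, DD±'s hypothesis demands 0 < n so it is not
vacuous-by-zero; no junk truth/falsity; universes Type throughout = ROOT. NECESSITY: S ⟹ E, CU, X₁,
DD± all KERNEL. EXACTNESS: S ⟺ E ∧ CU ∧ X₁ ∧ DD± and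
R ⟺ CU ∧ X₁ ∧ DD± KERNEL. GUARDS R5 ✓ R6 ✓ (refines DD; CU is a genuinely new attacked statement) R7
✓; difficulty distributed; no dial»; CRITIC-LEDGER.md
row 04:44:38Z); per-piece critic tags are appended to each item below. Why this is novel (one
sentence): this is the first node of the tree that carves
the definite residual along CHIRALITY — ChiralUpgrade = «the Khovanov/gl₂-blind complement is all of
E's population» (MMSW Q9.12's hypothesis factored
through E), a typed, S-independent-decidable (Φ2 both signs, every amphichiral Σ) and instrumentable
piece of B's residual.

RANKED CRUXES. #2 ChiralUpgrade (crux) — CU — CHIRAL UPGRADE (NEW; the ATTACKED piece): if a smooth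
homotopy 4-sphere M dissolves along ONE coherently oriented one-chirality blow-up chain (exactly the
data of B’s DefiniteCancellation #24778: M # nℂℙ² ≅ #nℂℙ² for one sign), then for EVERY orientation
oM of M and EVERY chirality c₀ of ℂℙ² there is a PINNED chain (P′ 0 ≅ M orientation-preservingly,
each step an oriented connected sum with (ℂℙ², c₀), Q′-side from S⁴, P′ m ≅ Q′ m): M dissolves in
ℂℙ² AND in ℂℙ²bar. Equivalently (kernel `biDefiniteDissolution_iff_and`) E ∧ CU ⟺ E± = the
hypothesis of MMSW §9.3 / Q9.12. WEAKER: CU ⟸ R, ⟸ S, ⟸ CP2Rigid (kernel); DECIDED TRUE on Φ2 both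
signs and on every amphichiral Σ ⊇ all doubles D(P) (kernel); OPEN exactly on chiral
one-sign-dissolvable candidates; probes CU ⟹ S, CU ⟹ R, CU outright FAIL (bc/probes.lean P1/P5/P3);
BC7 CLEAN. [critic decomp-sp4-crit-1 g2, CLEARED 2026-08-30T04:44:38Z (HOME/STATUS.md line 188): NEW
· ATTACKED · WEAKER (⟸ R #24778, ⟸ S, ⟸ CP2Rigid = hyp hC of
Barriers.not_fgmwRasmussenStrategy_of_cp2Rigid — all kernel) · GENUINE-P3 (decided TRUE with S open:
every Gluck twist, both signs, kernel mod the two named tree facts GluckTwistsHomotopySpheres +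
gluckTwist_connectedSum_complexProjectivePlane; every AMPHICHIRAL Σ incl. all doubles D(P) = Φ4,
kernel unconditional chiralUpgrade_on_amphichiral) · KILLABLE/INSTRUMENTABLE (a chiral Σ dissolving
in one chirality only kills it; chirality-sensitive instruments: Rasmussen s of ribbon presentations
MMSW §9.3, gl₂ lasagna Ren–Willis Prop 6.17, M10-ℂℙ²± both signs on non-amphichiral candidates;
honest remark: CU’s content sits on CHIRAL homotopy spheres, none known to exist, so the undecided
rows have no specimen today — the P3 rows are the decided-TRUE families)] [difficulty: open-problem]
(why it might fail: For exotic pairs with b⁺ ≥ 1 dissolution IS chiral: X # ℂℙ² dissolves (Wall,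
Mandelbaum–Moishezon) but X # kℂℙ²bar stays exotic (SW blow-up formula). CU bets the asymmetry dies
on homotopy spheres (no invariant survives a blow-up); a chiral exotic Σ with (+1)-spheres of one
sign only refutes it.) [arXiv:1910.08195, GluckTAMS1962, arXiv:1205.6038, GompfStipsicz1999,
FintushelStern1995, RenWillis2024, arXiv:0906.5177]
#3 BiDefiniteDescent (crux) — DD± — BI-DEFINITE DESCENT / RANK COLLAPSE GIVEN BOTH CHIRALITIES (NEW;
DECLARED RESIDUAL): if a smooth homotopy 4-sphere M admits, for EVERY orientation oM and EVERY
chirality c₀ of ℂℙ², a pinned blow-up chain of POSITIVE length ending in a standard #nℂℙ² (M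
dissolves in ℂℙ² and in ℂℙ²bar at some positive ranks), then some connected sum M # ℂℙ² is already
diffeomorphic to ℂℙ² (rank one, orientation-free — exactly X₁’s hypothesis). WEAKER than B’s layer-2
residual child DefiniteDescent #26487 (kernel `biDefiniteDescent_of_definiteDescent`; DD assumes ONE
one-chirality chain) and than R; TRUE on Φ2 (kernel mod the two tree facts); probes DD± ⟹ S, DD± ⟹
R, DD± outright FAIL (P2/P6/P4); BC7 CLEAN; the positive-length hypothesis 0 < n excludes
vacuity-by-zero. [critic decomp-sp4-crit-1 g2, CLEARED 2026-08-30T04:44:38Z (HOME/STATUS.md line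
188): NEW · DECLARED-RESIDUAL (tribunal_fit residual) · WEAKER (⟸ DD #26487, ⟸ R #24778 — kernel) ·
TRUE on Φ2 (rank-one dissolution outright) · IDEA-NEEDED (rank collapse given both chiralities; the
bi-chirality hypothesis is exactly a ℂℙ² # ℂℙ²bar = S²×~S²-type stabilisation handle pair — LATTICE
EDGE (paper) to lens-3 g4’s S²×S² column / KM k-pair dictionary)] [difficulty: open-problem] (why it
might fail: Rank collapse can fail one level down: 'one stabilisation is not enough' for
corks/contractible 4-manifolds (Kang arXiv:2210.07510) and surfaces (Hayden–Kang–Mukherjee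
arXiv:2304.01504); a homotopy sphere might dissolve in both chiralities only at rank ≥ 2; no
ℂℙ²-peeling mechanism is known.) [arXiv:2210.07510, arXiv:2304.01504, arXiv:2207.11847,
doi:10.1016/s0166-8641(02)00063-9, doi:10.1016/0040-9383(91)90036-4, arXiv:1910.08195]
#4 DefiniteDissolution (crux) — E — DEFINITE DISSOLUTION (= stmt-SmoothPoincare4-24779
`RootDecompB.DefiniteDissolution` VERBATIM — dedup by signature intended; B’s ATTACKED piece,
pooled): every smooth homotopy 4-sphere M dissolves along some coherently oriented one-chirality
blow-up chain — M # nℂℙ² ≅ #nℂℙ² for ONE sign and some n ≥ 0 (n = 0 allowed and meaning M ≅ S⁴). S ⟹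
E (kernel); E ⟹̸ S (B’s probes); load-bearing in closes (its chain is what CU upgrades). [critic
decomp-sp4-crit-1 g2, CLEARED 2026-08-30T04:44:38Z (HOME/STATUS.md line 188): =
stmt-SmoothPoincare4-24779 POOLED (B’s attacked piece, unchanged; body byte-identical to
RootDecompB.DefiniteDissolution) · critic tags of B stand: WEAKER ⟸ DissolveOne #17710 · ATTACKABLE
· INSTRUMENTABLE M10-ℂℙ²] [difficulty: open-problem] (why it might fail: a homotopy sphere built to
defeat the FGMW s-strategy’s converse could resist one-sign blow-ups at every rank; only Gluck
twists (n = 1) and Gompf’s H_(n,k) family are verified; MMSW Q9.12 is open even for presentation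
spheres D(P).) [arXiv:1910.08195, doi:10.1016/0040-9383(91)90036-4, arXiv:2210.07510,
Gompf1991Killing]
#5 CP2CancellationOne (crux) — X₁ — ℂℙ²-CANCELLATION AT RANK ONE, orientation-free (=
stmt-SmoothPoincare4-17708 `RootDecompB.CP2CancellationOne` = `DissolvableGluck.CP2CancellationOne`
VERBATIM — dedup by signature intended; pooled summit-grade recognition debt, counted once per
summit): M ≃ₕ S⁴ and M # ℂℙ² ≅ ℂℙ² ⟹ M ≅ S⁴. Load-bearing in closes (probe P8: CU → X₁ → S fails;
P7: CU → DD± → R fails). [critic decomp-sp4-crit-1 g2, CLEARED 2026-08-30T04:44:38Z (HOME/STATUS.md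
line 188): = stmt-SmoothPoincare4-17708 POOLED (byte-identical to RootDecompB.CP2CancellationOne and
DissolvableGluck.CP2CancellationOne, critic rfl) · summit-grade recognition, COSTUME-class pooled
debt (unchanged from B rev 1 / DissolvableGluck; counted once per summit) · load-bearing in closes
(probe P8: E ∧ CU ∧ DD± ↛ S cheaply? — P8 = CU → X₁ → S fails, P7 = CU → DD± → R fails)]
[difficulty: open-problem] (why it might fail: X₁ = DIG ∧ GLUCK: the (+1)-sphere of a rank-one
dissolution need not be standard (Melvin blow-down gives only «Gluck twist on some 2-knot» if it
is), and Gluck twists need not be standard (Kirby Problems 4.24/4.45 open; GNS arXiv:2307.06388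
Q5.6).) [GompfStipsicz1999, doi:10.1016/0040-9383(91)90036-4, arXiv:0907.0136, Kirby1997,
arXiv:2307.06388]

TWO-LAYER PLAN. Layer 1 only at birth: E (pooled, attacked in B) ∧ CU (attacked) ∧ X₁ (pooled debt;
its own split DIG #17709 ∧ GLUCK #17711 lives in DissolvableGluck) ∧ DD±
(declared residual). Foreseen glued splits (not filed): CU by family (Φ2 done in kernel mod tree
facts; amphichiral done; chiral candidates = the open
stratum); DD± ⟸ DD #26487 (kernel, to be landed --supports DD±). Relation to B (for TREE.md): S ⟺ E
∧ R (B) and R ⟺ CU ∧ X₁ ∧ DD± (this node, kernel) —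
B’s rev-1 split R ⟸ X₁ ∧ DD stays B’s decomposition of record; this route is the OR-sibling carrying
the finer 3-way family because `--resplit` on B is
reserved to B’s tenure planner / the operator (writer attempt refused, nothing recorded).

KILL CRITERIA. A refutation of ChiralUpgrade is a CHIRAL homotopy sphere dissolving in one sign only
— it kills this route (refuted:ChiralUpgrade), kills B’s R, and names
exactly where a chirality-sensitive functorial invariant (s, gl₂ lasagna) could bite; a refutation
of BiDefiniteDescent is a homotopy sphere dissolving in
both chiralities only at rank ≥ 2 — kills this route and B’s DD/R; a refutation of E or X₁ is an
exotic S⁴ (closes the summit negatively). A proof of CU alone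
retires the s/gl₂ strategy on all of E’s population (barrier extended from Φ2 to «one-sign
dissolvable») and leaves X₁ ∧ DD± ∧ E. DissolveOne #17710 proved
⟹ E moot (proved). If the operator runs the prepared resplit on B, this route is closed
superseded-by route-SmoothPoincare4-RootDecompB.

NOT DECOMPOSED YET. No per-family items (Φ2 / amphichiral rungs are ASIDE per the named-rung rule
and live in the lens certificate: chiralUpgrade_on_gluckTwists,
chiralUpgrade_on_amphichiral, biDefiniteDescent_on_gluckTwists, chiralUpgrade_of_cp2Rigid,
biDefiniteDissolution_iff_and, cp2Rigid_of_spc4); no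
metric/gauge sub-claims; the dominations CU ⟸ R, DD± ⟸ DD, E ⟸ DissolveOne are prover W-items
(GlueLandings §3), not items.

CHEAPEST FALSIFIER. Census run «M10-ℂℙ²±» (menu M10 with blow-ups of BOTH signs separately): on the
non-amphichiral candidate homotopy spheres of the census (residual
presentation spheres T ≤ 18 that are not doubles, R-links of 15–16 crossings, MP rows 16n68278 /
18nh_00000601, bounded cork twists) search slide
certificates Σ # kℂℙ² ≅ #kℂℙ² AND Σ # kℂℙ²bar ≅ #kℂℙ²bar, k ≤ 3; a one-sign-only pattern persisting
under deeper search is the cheapest evidence against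
CU (not a proof); not run here (kit not allowed in this seat). Consistency check in print: a
both-sign certificate for a Σ with a knot K slice in Σ° and
s(K) ≠ 0 contradicts MMSW.

NUMBERS. CU decided TRUE: all Gluck twists (both signs; n = 1), all amphichiral Σ incl. every double
D(P) and every Σ # −Σ (kernel). Chiral exotic closed simply
connected DEFINITE pairs known: none at any b₂ (Stipsicz–Szabó 2024 §1); chirality of dissolution at
b⁺ ≥ 1: X # ℂℙ² dissolves (Wall; Mandelbaum–Moishezon)
while X # kℂℙ²bar stays exotic (SW blow-up formula). Probes: 8/8 FAILED as required
(bc/probes.lean); BC7: ChiralUpgrade CLEAN, BiDefiniteDescent CLEAN.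

DEFINITION REQUESTS. None: IsOrientedConnectedSum, SmoothOrientation (+ .IsOrientationPreserving),
ComplexProjectivePlane, Diffeomorph are tree / Mathlib declarations; the
pinned chain is spelled out inside the bodies (no new def).

Novelty: Searches RUN (lens, recorded in NODE.md; writer did not re-run): corpus hybrid "homotopy 4-sphere
connected sum CP2 reversed orientation dissolve
amphicheiral" → [corpus:gordon1984 pp.44–47], [corpus:kirby1989 pp.87–89] opened, unrelated (CS/ℝP⁴,
exotic ℝ⁴); vsearch of the prose statement → same
books; galaxy --star all needles "amphicheiral homotopy|CP2 bar summand|dissolves after one" → 0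
relevant rows; lean search/find for a chirality-upgrade
statement → none. Nearest prior art FOUND: MMSW arXiv:1910.08195 §9.3 remark + Q9.12
[corpus:paper:arxiv-1910.08195 p.30 L25/L29] (asks both signs for
D(P), never the upgrade one ⟹ both); Akbulut–Yasui arXiv:1205.6038 Cor 1.3 (Φ2: either sign); Gluck
1962 §8; the SW blow-up formula (the chiral phenomenon
for b⁺ ≥ 1). Nearest routes: RootDecompB (same programme, RANK axis; this node refines its
residual), DissolvableGluck (X₁ pooled), RootDecompA/C/G/L (mirror
of Σ, not sign of the blow-up). Delta in one sentence: the first typed «one chirality ⟹ both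
chiralities» statement for homotopy spheres, exact as a 3-way
carving of B’s residual and decided TRUE on Φ2 and on all amphichiral Σ with S open. Claimed grade:
new-combination (lens claim; the tribunal/J seat grades).  [refs: 1910.08195, 1205.6038, paper:arxiv-1910.08195]

Barriers (technique_class: kirby-calculus, blow-ups, definite forms, chirality): - technique_class: kirby-calculus, blow-ups, definite forms, chirality
- Literature.Barriers.SmoothPoincare4.GluckTwistCP2Barrier: it does not evade it; the bet is
declared — X₁ at rank one contains the Gluck twist conjecture (pooled debt), while CU and DD± are
TRUE on the Gluck family in both signs (kernel mod the tree dissolution fact): the barrier’s content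
is evidence for the attacked piece, obstacle only for the pooled debt.
- Literature.Barriers.SmoothPoincare4.SmallExoticaBarrier: outside — every piece is graded through
the DEFINITE family ±nℂℙ² with homotopy-sphere summand (b₂(Σ) = 0); the small-exotica witnesses
(Akhmedov–Park, odd indefinite, b₂ = 3) are mixed sums excluded by the pinned one-chirality chains;
CU asserts a population symmetry, not rigidity of #nℂℙ².
- Literature.Barriers.SmoothPoincare4.StableBarrierFour: outside — no piece uses a stable (S²×S²- or
bordism-) invariant; DD±’s hypothesis is a ℂℙ² # ℂℙ²bar-type pair only implicitly (lattice edge to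
lens-3 g4, recorded, not used).
- Literature.Barriers.SmoothPoincare4.OneStabilisationBarrier: DD± sits inside the phenomenon’s
shadow one categorical level up (Kang 2022 / HKM 2023: one stabilisation is not enough for corks /
surfaces) — honest: it does not evade; the bet is that closed homotopy spheres dissolve at rank 1
whenever they dissolve (true on every known family).
- Khovanov / skein-lasagna blindness (the SPC4 Barriers module GluckTwistsDissolve, theorem
not_fgmwRasmussenStrategy_of_cp2Rigid; Ren–W

History (route lifecycle, newest last):
- 2026-08-31T02:27:44Z · RESIDUAL declared: AmphichiralDescent (stmt-SmoothPoincare4-28675) — summit-strength until shown otherwise: g18 schema migration (D-0170): tribunal residual of record (stmt-SmoothPoincare4-28675, route tribunal.residual; TREE-IN (planner-decomp-sp4-writer-1-g18-0)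
- 2026-08-31T02:27:45Z · RESIDUAL declared: CP2CancellationOne (stmt-SmoothPoincare4-17708) — summit-strength until shown otherwise: g18 schema migration (D-0170): tribunal residual of record (stmt-SmoothPoincare4-17708, route tribunal.residual; TREE-IN (planner-decomp-sp4-writer-1-g18-0)
- 2026-09-04T16:53:01Z · DORMANT — reconciler: no traction for 5.1 d (last activity item-proof-filed at 2026-08-30T15:03:03Z); parked, not closed — `ledger route dormant route-SmoothPoincare4-Roo (operator:999:1077454)

sub-problem: SmoothPoincare4 · status: dormant · opened planner-decomp-sp4-writer-1-g2-0 2026-08-30T04:53:34Z · rev 3 · ledger route-SmoothPoincare4-RootDecompN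
GENERATED by the gate from the ledger (D-0016/17). Provers cite these decls: `theorem foo : Summit.SmoothPoincare4.SmoothPoincare4.Theses.RootDecompN.<Decl> := …` in Summits/SmoothPoincare4/SmoothPoincare4/Theorems/<Name>.lean.
-/

namespace Summit.SmoothPoincare4.SmoothPoincare4.Theses.RootDecompN

open scoped BigOperators Topology Manifold Classical MeasureTheory ProbabilityTheory Matrix InnerProductSpace ComplexConjugate ContinuousMap
open Filter Set Function TopologicalSpace MeasureTheory

attribute [summit_statement] _root_.SmoothPoincare4

open Literature.SPC4

/-- item stmt-SmoothPoincare4-28144 · crux · rank 2 · open · by planner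
why it might fail: For exotic pairs with b⁺ ≥ 1 dissolution IS chiral: X # ℂℙ² dissolves (Wall, Mandelbaum–Moishezon) but X # kℂℙ²bar stays exotic (SW blow-up formula). CU bets the asymmetry dies on homotopy spheres (no invariant survives a blow-up); a chiral exotic Σ with (+1)-spheres of one sign only refutes it.
sources: arXiv:1910.08195, GluckTAMS1962, arXiv:1205.6038, GompfStipsicz1999, FintushelStern1995, RenWillis2024
[crux] CU — CHIRAL UPGRADE (NEW; the ATTACKED piece): if a smooth homotopy 4-sphere M dissolves
along ONE coherently oriented one-chirality blow-up chain (exactly the data of B’s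
DefiniteCancellation #24778: M # nℂℙ² ≅ #nℂℙ² for one sign), then for EVERY orientation oM of M and
EVERY chirality c₀ of ℂℙ² there is a PINNED chain (P′ 0 ≅ M orientation-preservingly, each step an
oriented connected sum with (ℂℙ², c₀), Q′-side from S⁴, P′ m ≅ Q′ m): M dissolves in ℂℙ² AND in
ℂℙ²bar. Equivalently (kernel `biDefiniteDissolution_iff_and`) E ∧ CU ⟺ E± = the hypothesis of MMSW
§9.3 / Q9.12. WEAKER: CU ⟸ R, ⟸ S, ⟸ CP2Rigid (kernel); DECIDED TRUE on Φ2 both signs and on every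
amphichiral Σ ⊇ all doubles D(P) (kernel); OPEN exactly on chiral one-sign-dissolvable candidates;
probes CU ⟹ S, CU ⟹ R, CU outright FAIL (bc/probes.lean P1/P5/P3); BC7 CLEAN. [critic
decomp-sp4-crit-1 g2, CLEARED 2026-08-30T04:44:38Z (HOME/STATUS.md line 188): NEW · ATTACKED ·
WEAKER (⟸ R #24778, ⟸ S, ⟸ CP2Rigid = hyp hC of Barriers.not_fgmwRasmussenStrategy_of_cp2Rigid — all
kernel) · GENUINE-P3 (decided TRUE with S open: every Gluck twist, both signs, kernel mod the two
named tree facts GluckTwistsHomotopySpheres + glu -/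
@[route_item "route-SmoothPoincare4-RootDecompN"]
def ChiralUpgrade : Prop :=
  open scoped ContDiff in ∀ (M : Type) [TopologicalSpace M] [T2Space M] [SecondCountableTopology M] [ChartedSpace (EuclideanSpace ℝ (Fin 4)) M] [IsManifold (𝓡 4) ∞ M], Nonempty (ContinuousMap.HomotopyEquiv M (Metric.sphere (0 : EuclideanSpace ℝ (Fin 5)) 1)) → ∀ (n : ℕ) (P Q : ℕ → Type) [∀ i, TopologicalSpace (P i)] [∀ i, T2Space (P i)] [∀ i, SecondCountableTopology (P i)] [∀ i, ChartedSpace (EuclideanSpace ℝ (Fin 4)) (P i)] [∀ i, IsManifold (𝓡 4) ∞ (P i)] [∀ i, CompactSpace (P i)] [∀ i, TopologicalSpace (Q i)] [∀ i, T2Space (Q i)] [∀ i, SecondCountableTopology (Q i)] [∀ i, ChartedSpace (EuclideanSpace ℝ (Fin 4)) (Q i)] [∀ i, IsManifold (𝓡 4) ∞ (Q i)] [∀ i, CompactSpace (Q i)] (o : ∀ i, Literature.Topology.FourManifolds.SmoothOrientation (𝓡 4) (P i)) (c : ∀ i, i < n → Literature.Topology.FourManifolds.SmoothOrientation (𝓡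 4) Literature.Topology.FourManifolds.ComplexProjectivePlane), Nonempty (P 0 ≃ₘ⟮𝓡 4, 𝓡 4⟯ M) → Nonempty (Q 0 ≃ₘ⟮𝓡 4, 𝓡 4⟯ (Metric.sphere (0 : EuclideanSpace ℝ (Fin 5)) 1)) → (∀ i (hi : i < n), Literature.Topology.FourManifolds.IsOrientedConnectedSum (o i) (c i hi) (o (i + 1))) → (∀ i j (hi : i < n) (hj : j < n), c i hi = c j hj) → (∀ i < n, Literature.Topology.FourManifolds.IsConnectedSum (𝓡 4) (𝓡 4) (𝓡 4) (Q i) Literature.Topology.FourManifolds.ComplexProjectivePlane (Q (i + 1))) → Nonempty (P n ≃ₘ⟮𝓡 4, 𝓡 4⟯ Q n) → ∀ (oM : Literature.Topology.FourManifolds.SmoothOrientation (𝓡 4) M) (c₀ : Literature.Topology.FourManifolds.SmoothOrientation (𝓡 4) Literature.Topology.FourManifolds.ComplexProjectivePlane), ∃ (m : ℕ) (P' Q' : ℕ → Type) (_ : ∀ i, TopologicalSpace (P' i)) (_ : ∀ i, T2Space (P' i)) (_ : ∀ i, SecondCountableTopology (P' i)) (_ : ∀ i, ChartedSpace (EuclideanSpace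 ℝ (Fin 4)) (P' i)) (_ : ∀ i, IsManifold (𝓡 4) ∞ (P' i)) (_ : ∀ i, CompactSpace (P' i)) (_ : ∀ i, TopologicalSpace (Q' i)) (_ : ∀ i, T2Space (Q' i)) (_ : ∀ i, SecondCountableTopology (Q' i)) (_ : ∀ i, ChartedSpace (EuclideanSpace ℝ (Fin 4)) (Q' i)) (_ : ∀ i, IsManifold (𝓡 4) ∞ (Q' i)) (_ : ∀ i, CompactSpace (Q' i)) (o' : ∀ i, Literature.Topology.FourManifolds.SmoothOrientation (𝓡 4) (P' i)), (∃ e : P' 0 ≃ₘ⟮𝓡 4, 𝓡 4⟯ M, e.IsOrientationPreserving (o' 0) oM) ∧ Nonempty (Q' 0 ≃ₘ⟮𝓡 4, 𝓡 4⟯ (Metric.sphere (0 : EuclideanSpace ℝ (Fin 5)) 1)) ∧ (∀ i < m, Literature.Topology.FourManifolds.IsOrientedConnectedSum (o' i) c₀ (o' (i + 1))) ∧ (∀ i < m, Literature.Topology.FourManifolds.IsConnectedSum (𝓡 4) (𝓡 4) (𝓡 4) (Q' i) Literature.Topology.FourManifolds.ComplexProjectivePlane (Q' (i + 1))) ∧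 Nonempty (P' m ≃ₘ⟮𝓡 4, 𝓡 4⟯ Q' m)

/-- item stmt-SmoothPoincare4-28145 · crux · rank 3 · SPLIT (gen 1) into AmphichiralDescent, ChiralDescent + glue BiDefiniteDescentAmphGlue · direct attempts still welcome (low priority) · by planner
why it might fail: Rank collapse can fail one level down: 'one stabilisation is not enough' for corks/contractible 4-manifolds (Kang arXiv:2210.07510) and surfaces (Hayden–Kang–Mukherjee arXiv:2304.01504); a homotopy sphere might dissolve in both chiralities only at rank ≥ 2; no ℂℙ²-peeling mechanism is known.
sources: arXiv:2210.07510, arXiv:2304.01504, arXiv:2207.11847, doi:10.1016/s0166-8641(02)00063-9, doi:10.1016/0040-9383(91)90036-4, arXiv:1910.08195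
[crux] DD± — BI-DEFINITE DESCENT / RANK COLLAPSE GIVEN BOTH CHIRALITIES (NEW; DECLARED RESIDUAL): if
a smooth homotopy 4-sphere M admits, for EVERY orientation oM and EVERY chirality c₀ of ℂℙ², a
pinned blow-up chain of POSITIVE length ending in a standard #nℂℙ² (M dissolves in ℂℙ² and in ℂℙ²bar
at some positive ranks), then some connected sum M # ℂℙ² is already diffeomorphic to ℂℙ² (rank one,
orientation-free — exactly X₁’s hypothesis). WEAKER than B’s layer-2 residual child DefiniteDescent
#26487 (kernel `biDefiniteDescent_of_definiteDescent`; DD assumes ONE one-chirality chain) and than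
R; TRUE on Φ2 (kernel mod the two tree facts); probes DD± ⟹ S, DD± ⟹ R, DD± outright FAIL
(P2/P6/P4); BC7 CLEAN; the positive-length hypothesis 0 < n excludes vacuity-by-zero. [critic
decomp-sp4-crit-1 g2, CLEARED 2026-08-30T04:44:38Z (HOME/STATUS.md line 188): NEW ·
DECLARED-RESIDUAL (tribunal_fit residual) · WEAKER (⟸ DD #26487, ⟸ R #24778 — kernel) · TRUE on Φ2
(rank-one dissolution outright) · IDEA-NEEDED (rank collapse given both chiralities; the
bi-chirality hypothesis is exactly a ℂℙ² # ℂℙ²bar = S²×~S²-type stabilisation handle pair — LATTICE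
EDGE (paper) to lens-3 g4’s S²×S² column / KM k -/
@[route_item "route-SmoothPoincare4-RootDecompN"]
def BiDefiniteDescent : Prop :=
  open scoped ContDiff in ∀ (M : Type) [TopologicalSpace M] [T2Space M] [SecondCountableTopology M] [ChartedSpace (EuclideanSpace ℝ (Fin 4)) M] [IsManifold (𝓡 4) ∞ M], Nonempty (ContinuousMap.HomotopyEquiv M (Metric.sphere (0 : EuclideanSpace ℝ (Fin 5)) 1)) → (∀ (oM : Literature.Topology.FourManifolds.SmoothOrientation (𝓡 4) M) (c₀ : Literature.Topology.FourManifolds.SmoothOrientation (𝓡 4) Literature.Topology.FourManifolds.ComplexProjectivePlane), ∃ (n : ℕ) (P Q : ℕ → Type) (_ : ∀ i, TopologicalSpace (P i)) (_ : ∀ i, T2Space (P i)) (_ : ∀ i, SecondCountableTopology (P i)) (_ : ∀ i, ChartedSpace (EuclideanSpace ℝ (Fin 4)) (P i)) (_ : ∀ i, IsManifold (𝓡 4) ∞ (P i)) (_ : ∀ i, CompactSpace (P i)) (_ : ∀ i, TopologicalSpace (Q i)) (_ : ∀ i, T2Space (Q i)) (_ : ∀ i, SecondCountableTopology (Q i))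 (_ : ∀ i, ChartedSpace (EuclideanSpace ℝ (Fin 4)) (Q i)) (_ : ∀ i, IsManifold (𝓡 4) ∞ (Q i)) (_ : ∀ i, CompactSpace (Q i)) (o : ∀ i, Literature.Topology.FourManifolds.SmoothOrientation (𝓡 4) (P i)), 0 < n ∧ (∃ e : P 0 ≃ₘ⟮𝓡 4, 𝓡 4⟯ M, e.IsOrientationPreserving (o 0) oM) ∧ Nonempty (Q 0 ≃ₘ⟮𝓡 4, 𝓡 4⟯ (Metric.sphere (0 : EuclideanSpace ℝ (Fin 5)) 1)) ∧ (∀ i < n, Literature.Topology.FourManifolds.IsOrientedConnectedSum (o i) c₀ (o (i + 1))) ∧ (∀ i < n, Literature.Topology.FourManifolds.IsConnectedSum (𝓡 4) (𝓡 4) (𝓡 4) (Q i) Literature.Topology.FourManifolds.ComplexProjectivePlane (Q (i + 1))) ∧ Nonempty (P n ≃ₘ⟮𝓡 4, 𝓡 4⟯ Q n)) → ∃ (P' : Type) (_ : TopologicalSpace P') (_ : T2Space P') (_ : SecondCountableTopology P') (_ : ChartedSpace (EuclideanSpace ℝ (Fin 4)) P') (_ : IsManifold (𝓡 4) ∞ P'),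 Literature.Topology.FourManifolds.IsConnectedSum (𝓡 4) (𝓡 4) (𝓡 4) M Literature.Topology.FourManifolds.ComplexProjectivePlane P' ∧ Nonempty (P' ≃ₘ⟮𝓡 4, 𝓡 4⟯ Literature.Topology.FourManifolds.ComplexProjectivePlane)

-- parent: BiDefiniteDescent · child (gen 1)
/--     item stmt-SmoothPoincare4-28675 · crux · RESIDUAL (gen 0; summit-strength until shown otherwise, D-0170) · rank 301 · open
    parent: BiDefiniteDescent · by planner
    why it might fail: Rank collapse can fail one level down even with symmetry: ‘one stabilization is not enough’ for corks (Kang arXiv:2210.07510) whose doubles are exactly DDA’s population; an amphichiral Σ = D(H) might dissolve in both chiralities only at rank ≥ 2, and ρ gives no handle on the rank.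
    sources: arXiv:2210.07510, arXiv:2304.01504, arXiv:1910.08195 Q9.12 / §9.3, Gompf1991 doi:10.1016/0040-9383(91)90036-4, GompfStipsicz1999 Ex. 5.2.7(b), arXiv:2207.11847
DDA — AMPHICHIRAL DESCENT (NEW, gen 5, DECLARED RESIDUAL): if a smooth homotopy 4-sphere M is
AMPHICHIRAL (for every orientation oM some self-diffeomorphism ρ : M ≅ M carries oM to −oM, i.e. M ≅
−M) and dissolves in EVERY chirality at positive rank (for every orientation oM and every chirality
c₀ of ℂℙ² a PINNED blow-up chain of length n ≥ 1 ending in a standard #nℂℙ² — the hypothesis of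
BiDefiniteDescent #28145 verbatim), then some connected sum M # ℂℙ² is already diffeomorphic to ℂℙ²
(rank one, orientation-free). KERNEL: AmphichiralDescent ⟺ DefiniteDescent (#26487) restricted to
amphichiral spheres ⟺ BiDefiniteDescent (#28145) restricted to amphichiral spheres (on an
amphichiral sphere one chain pins to all chiralities at the same length), so DDA is strictly below
BOTH registered residuals (DD → DD± → DDA, kernel). Population ⊇ every double D(H) = ∂(H × I) of a
contractible 2-handlebody = every presentation sphere Σ(P) = ∂N⁵(P) (MMSW 2023 Question 9.12's Φ4
family; amphichiral by the swap of the double — NODE.md Lemma AMPH-Φ4), every Σ of order ≤ 2 with Σ̄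
as inverse candidate, every Gluck twist Σ_K with K ≃ mirror(K). Tags: NEW · WEAKER (kernel ⟸ DD, ⟸
DD±, ⟸ R, ⟸ AmphichiralSt -/
@[route_item "route-SmoothPoincare4-RootDecompN"]
def AmphichiralDescent : Prop :=
  open scoped ContDiff in ∀ (M : Type) [TopologicalSpace M] [T2Space M] [SecondCountableTopology M] [ChartedSpace (EuclideanSpace ℝ (Fin 4)) M] [IsManifold (𝓡 4) ∞ M], Nonempty (ContinuousMap.HomotopyEquiv M (Metric.sphere (0 : EuclideanSpace ℝ (Fin 5)) 1)) → (∀ (oM : Literature.Topology.FourManifolds.SmoothOrientation (𝓡 4) M), ∃ ρ : M ≃ₘ⟮𝓡 4, 𝓡 4⟯ M, ρ.IsOrientationPreserving oM (-oM)) → (∀ (oM : Literature.Topology.FourManifolds.SmoothOrientation (𝓡 4) M) (c₀ : Literature.Topology.FourManifolds.SmoothOrientation (𝓡 4) Literature.Topology.FourManifolds.ComplexProjectivePlane), ∃ (n : ℕ) (P Q : ℕ → Type) (_ : ∀ i, TopologicalSpace (P i)) (_ : ∀ i, T2Space (P i)) (_ : ∀ i, SecondCountableTopology (P i)) (_ :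 ∀ i, ChartedSpace (EuclideanSpace ℝ (Fin 4)) (P i)) (_ : ∀ i, IsManifold (𝓡 4) ∞ (P i)) (_ : ∀ i, CompactSpace (P i)) (_ : ∀ i, TopologicalSpace (Q i)) (_ : ∀ i, T2Space (Q i)) (_ : ∀ i, SecondCountableTopology (Q i)) (_ : ∀ i, ChartedSpace (EuclideanSpace ℝ (Fin 4)) (Q i)) (_ : ∀ i, IsManifold (𝓡 4) ∞ (Q i)) (_ : ∀ i, CompactSpace (Q i)) (o : ∀ i, Literature.Topology.FourManifolds.SmoothOrientation (𝓡 4) (P i)), 0 < n ∧ (∃ e : P 0 ≃ₘ⟮𝓡 4, 𝓡 4⟯ M, e.IsOrientationPreserving (o 0) oM) ∧ Nonempty (Q 0 ≃ₘ⟮𝓡 4, 𝓡 4⟯ (Metric.sphere (0 : EuclideanSpace ℝ (Fin 5)) 1)) ∧ (∀ i < n, Literature.Topology.FourManifolds.IsOrientedConnectedSum (o i) c₀ (o (i + 1))) ∧ (∀ i < n, Literature.Topology.FourManifolds.IsConnectedSum (𝓡 4) (𝓡 4) (𝓡 4) (Q i) Literature.Topology.FourManifolds.ComplexProjectivePlane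 (Q (i + 1))) ∧ Nonempty (P n ≃ₘ⟮𝓡 4, 𝓡 4⟯ Q n)) → ∃ (P' : Type) (_ : TopologicalSpace P') (_ : T2Space P') (_ : SecondCountableTopology P') (_ : ChartedSpace (EuclideanSpace ℝ (Fin 4)) P') (_ : IsManifold (𝓡 4) ∞ P'), Literature.Topology.FourManifolds.IsConnectedSum (𝓡 4) (𝓡 4) (𝓡 4) M Literature.Topology.FourManifolds.ComplexProjectivePlane P' ∧ Nonempty (P' ≃ₘ⟮𝓡 4, 𝓡 4⟯ Literature.Topology.FourManifolds.ComplexProjectivePlane)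

-- parent: BiDefiniteDescent · child (gen 1)
/--     item stmt-SmoothPoincare4-28676 · crux · rank 302 · open
    parent: BiDefiniteDescent · by planner
    why it might fail: Bi-dissolution only yields an oriented diffeo (Σ,o) # nℂℙ² ≅ (Σ,−o) # nℂℙ² (Wall 1964 realisation); descending it to Σ ≅ −Σ is a DEFINITE cancellation problem for the mirror pair — the same wall as R #24778; a chiral ℂℙ²-rigid exotic Σ refutes BA and leaves DDC with real content.
    sources: Wall1964 doi:10.1112/jlms/s1-39.1.131, GluckTAMS1962 §8, Gordon1976 doi:10.1007/BF02568175, arXiv:1910.08195 §9.3, arXiv:2210.07510, Kirby1997 Problems 4.24/4.45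
DDC — CHIRAL DESCENT (NEW, gen 5, UNDECIDED · possibly vacuous, the ATTACKED child): the same
rank-one descent for the CHIRAL (non-amphichiral: NOT every orientation is reversed by a
self-diffeomorphism) bi-definitely dissolvable smooth homotopy 4-spheres. No homotopy 4-sphere is
KNOWN to be chiral (doubles Φ4 are amphichiral by the swap; every specimen proved standard is
trivially amphichiral; for the remaining Gluck-twist / Cappell–Shaneson specimens amphichirality is
itself an open desk question), so DDC may well be VACUOUSLY true; its natural proof route is the
support statement BiDissolvableAmphichiral (BA: 'a sphere that dissolves in both chiralities is
amphichiral', kernel BA → DDC by vacuity), itself S-implied (S⁴ is amphichiral: hyperplane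
reflection, tree theorem sphereReflection_isOrientationReversing_of_ne_zero) and implied by R #24778
(kernel) and by 'every homotopy 4-sphere is amphichiral' (open). EXACT SPLIT: BiDefiniteDescent ⟺
AmphichiralDescent ∧ ChiralDescent (kernel, excluded middle). Tags: NEW · WEAKER (kernel ⟸ DD±
#28145, ⟸ BA ⟸ R #24778) · UNDECIDED·possibly-vacuous (vacuous ⟺ BA) · TRUE on Φ2 (conclusion holds,
kernel mod facts) and on Φ4 (no chiral doubles -/
@[route_item "route-SmoothPoincare4-RootDecompN"]
def ChiralDescent : Prop :=
  open scoped ContDiff in ∀ (M : Type) [TopologicalSpace M] [T2Space M] [SecondCountableTopology M] [ChartedSpace (EuclideanSpace ℝ (Fin 4)) M] [IsManifold (𝓡 4) ∞ M], Nonempty (ContinuousMap.HomotopyEquiv M (Metric.sphere (0 : EuclideanSpace ℝ (Fin 5)) 1)) → ¬ (∀ (oM : Literature.Topology.FourManifolds.SmoothOrientation (𝓡 4) M), ∃ ρ : M ≃ₘ⟮𝓡 4, 𝓡 4⟯ M, ρ.IsOrientationPreserving oM (-oM)) → (∀ (oM : Literature.Topology.FourManifolds.SmoothOrientation (𝓡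 4) M) (c₀ : Literature.Topology.FourManifolds.SmoothOrientation (𝓡 4) Literature.Topology.FourManifolds.ComplexProjectivePlane), ∃ (n : ℕ) (P Q : ℕ → Type) (_ : ∀ i, TopologicalSpace (P i)) (_ : ∀ i, T2Space (P i)) (_ : ∀ i, SecondCountableTopology (P i)) (_ : ∀ i, ChartedSpace (EuclideanSpace ℝ (Fin 4)) (P i)) (_ : ∀ i, IsManifold (𝓡 4) ∞ (P i)) (_ : ∀ i, CompactSpace (P i)) (_ : ∀ i, TopologicalSpace (Q i)) (_ : ∀ i, T2Space (Q i)) (_ : ∀ i, SecondCountableTopology (Q i)) (_ : ∀ i, ChartedSpace (EuclideanSpace ℝ (Fin 4)) (Q i)) (_ : ∀ i, IsManifold (𝓡 4) ∞ (Q i)) (_ : ∀ i, CompactSpace (Q i)) (o : ∀ i, Literature.Topology.FourManifolds.SmoothOrientation (𝓡 4) (P i)), 0 < n ∧ (∃ e : P 0 ≃ₘ⟮𝓡 4, 𝓡 4⟯ M, e.IsOrientationPreserving (o 0) oM) ∧ Nonempty (Q 0 ≃ₘ⟮𝓡 4, 𝓡 4⟯ (Metric.sphere (0 : EuclideanSpace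 ℝ (Fin 5)) 1)) ∧ (∀ i < n, Literature.Topology.FourManifolds.IsOrientedConnectedSum (o i) c₀ (o (i + 1))) ∧ (∀ i < n, Literature.Topology.FourManifolds.IsConnectedSum (𝓡 4) (𝓡 4) (𝓡 4) (Q i) Literature.Topology.FourManifolds.ComplexProjectivePlane (Q (i + 1))) ∧ Nonempty (P n ≃ₘ⟮𝓡 4, 𝓡 4⟯ Q n)) → ∃ (P' : Type) (_ : TopologicalSpace P') (_ : T2Space P') (_ : SecondCountableTopology P') (_ : ChartedSpace (EuclideanSpace ℝ (Fin 4)) P') (_ : IsManifold (𝓡 4) ∞ P'), Literature.Topology.FourManifolds.IsConnectedSum (𝓡 4) (𝓡 4) (𝓡 4) M Literature.Topology.FourManifolds.ComplexProjectivePlane P' ∧ Nonempty (P' ≃ₘ⟮𝓡 4, 𝓡 4⟯ Literature.Topology.FourManifolds.ComplexProjectivePlane)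

-- parent: BiDefiniteDescent · glue (gen 1)
/--     item stmt-SmoothPoincare4-28677 · support · rank 303 · closed · proved by Summit.SmoothPoincare4.SmoothPoincare4.Theorems.RootDecompNBiDefiniteDescentAmphSplit.biDefiniteDescentAmphGlue_holds (prover)
    parent: BiDefiniteDescent · GLUE: children ⟹ parent · by planner
AmphichiralDescent → ChiralDescent → BiDefiniteDescent -/
@[route_item "route-SmoothPoincare4-RootDecompN"]
def BiDefiniteDescentAmphGlue : Prop :=
  AmphichiralDescent → ChiralDescent → BiDefiniteDescent

-- `BiDefiniteDescentAmphGlue` holds: proved by `Summit.SmoothPoincare4.SmoothPoincare4.Theorems.RootDecompNBiDefiniteDescentAmphSplit.biDefiniteDescentAmphGlue_holds` (its module imports this route file, so no `_holds` link can be stated here).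

/-- item stmt-SmoothPoincare4-24779 · crux · leaf ATTACKABLE · rank 4 · open · by planner
why it might fail: a homotopy sphere built to defeat the FGMW s-strategy’s converse could resist one-sign blow-ups at every rank; only Gluck twists (n = 1) and Gompf’s H_(n,k) family are verified; MMSW Q9.12 is open even for presentation spheres D(P).
sources: arXiv:1910.08195, doi:10.1016/0040-9383(91)90036-4, arXiv:2210.07510, Gompf1991Killing
[crux] every smooth homotopy 4-sphere M admits, for some n ≥ 0, a coherently oriented one-chirality
blow-up chain P 0 ≅ M, P (i+1) = P i # ℂℙ² and a chain Q 0 ≅ S⁴, Q (i+1) = Q i # ℂℙ² with P n ≅ Q n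
(M # nℂℙ² ≅ #nℂℙ² or M # nℂℙ²bar ≅ #nℂℙ²bar for some n). Critic verdict: WEAKER (census B3(b) ✓ALL
Φ2 — Gordon 1976 Thm 4.6 / Melvin, tree `dissolvesInCP2_of_isGluckTwist'`; Gompf 1991 p.102;
dominated by DissolveOne stmt-SmoothPoincare4-17710 and by rigidity of any single #nℂℙ²; printed
OPEN arXiv:1910.08195 Q9.12, arXiv:2210.07510 Q2) · ATTACKABLE (Kirby calculus) · INSTRUMENTABLE
(test M10-ℂℙ², ≈30 core-h) — CLEARED decomp-sp4-crit-1-g0 2026-08-30T01:33:40Z; node score = this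
piece. [difficulty: L] -/
@[route_item "route-SmoothPoincare4-RootDecompN"]
def DefiniteDissolution : Prop :=
  open scoped ContDiff in ∀ (M : Type) [TopologicalSpace M] [T2Space M] [SecondCountableTopology M] [ChartedSpace (EuclideanSpace ℝ (Fin 4)) M] [IsManifold (𝓡 4) ∞ M], Nonempty (ContinuousMap.HomotopyEquiv M (Metric.sphere (0 : EuclideanSpace ℝ (Fin 5)) 1)) → ∃ (n : ℕ) (P Q : ℕ → Type) (_ : ∀ i, TopologicalSpace (P i)) (_ : ∀ i, T2Space (P i)) (_ : ∀ i, SecondCountableTopology (P i)) (_ : ∀ i, ChartedSpace (EuclideanSpace ℝ (Fin 4)) (P i)) (_ : ∀ i, IsManifold (𝓡 4) ∞ (P i)) (_ : ∀ i, CompactSpace (P i)) (_ : ∀ i, TopologicalSpace (Q i)) (_ : ∀ i, T2Space (Q i)) (_ : ∀ i, SecondCountableTopology (Q i)) (_ : ∀ i, ChartedSpace (EuclideanSpace ℝ (Fin 4)) (Q i)) (_ : ∀ i, IsManifold (𝓡 4) ∞ (Q i)) (_ : ∀ i, CompactSpace (Q i)) (o : ∀ i, Literature.Topology.FourManifolds.SmoothOrientation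 (𝓡 4) (P i)) (c : ∀ i, i < n → Literature.Topology.FourManifolds.SmoothOrientation (𝓡 4) Literature.Topology.FourManifolds.ComplexProjectivePlane), Nonempty (P 0 ≃ₘ⟮𝓡 4, 𝓡 4⟯ M) ∧ Nonempty (Q 0 ≃ₘ⟮𝓡 4, 𝓡 4⟯ (Metric.sphere (0 : EuclideanSpace ℝ (Fin 5)) 1)) ∧ (∀ i (hi : i < n), Literature.Topology.FourManifolds.IsOrientedConnectedSum (o i) (c i hi) (o (i + 1))) ∧ (∀ i j (hi : i < n) (hj : j < n), c i hi = c j hj) ∧ (∀ i < n, Literature.Topology.FourManifolds.IsConnectedSum (𝓡 4) (𝓡 4) (𝓡 4) (Q i) Literature.Topology.FourManifolds.ComplexProjectivePlane (Q (i + 1))) ∧ Nonempty (P n ≃ₘ⟮𝓡 4, 𝓡 4⟯ Q n)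

/-- item stmt-SmoothPoincare4-17708 · crux · RESIDUAL (gen 0; summit-strength until shown otherwise, D-0170) · rank 5 · open · by planner
why it might fail: X₁ = DIG ∧ GLUCK: the (+1)-sphere of a rank-one dissolution need not be standard (Melvin blow-down gives only «Gluck twist on some 2-knot» if it is), and Gluck twists need not be standard (Kirby Problems 4.24/4.45 open; GNS arXiv:2307.06388 Q5.6).
sources: GompfStipsicz1999, doi:10.1016/0040-9383(91)90036-4, arXiv:0907.0136, Kirby1997, arXiv:2307.06388
[target] X₁ — every smooth homotopy 4-sphere M admitting a connected sum P of M with ℂℙ² that is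
diffeomorphic to ℂℙ² is diffeomorphic to S⁴ (TwistorDissolution's CP2Cancellation at n = 1, one sum
instead of a chain; the tree's IsConnectedSum is orientation-free, so both M # ℂℙ² and M # ℂℙ²bar
readings are included). -/
@[route_item "route-SmoothPoincare4-RootDecompN"]
def CP2CancellationOne : Prop :=
  open scoped ContDiff in ∀ (M : Type) [TopologicalSpace M] [T2Space M] [SecondCountableTopology M] [ChartedSpace (EuclideanSpace ℝ (Fin 4)) M] [IsManifold (𝓡 4) ∞ M], ContinuousMap.HomotopyEquiv M (Metric.sphere (0 : EuclideanSpace ℝ (Fin 5)) 1) → (∃ (P : Type) (_ : TopologicalSpace P) (_ : T2Space P) (_ : SecondCountableTopology P) (_ : ChartedSpace (EuclideanSpace ℝ (Fin 4)) P) (_ : IsManifold (𝓡 4) ∞ P), Literature.Topology.FourManifolds.IsConnectedSum (𝓡 4) (𝓡 4) (𝓡 4) M Literature.Topology.FourManifolds.ComplexProjectivePlane P ∧ Nonempty (P ≃ₘ⟮𝓡 4, 𝓡 4⟯ Literature.Topology.FourManifolds.ComplexProjectivePlane)) → Nonempty (M ≃ₘ⟮𝓡 4, 𝓡 4⟯ Metric.sphere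 (0 : EuclideanSpace ℝ (Fin 5)) 1)

/-- item stmt-SmoothPoincare4-28679 · support · rank 9 · SPLIT (gen 1) into ChiralityPinning, StableMirrorDescent + glue BiDissolvableAmphichiralMirrorGlue · direct attempts still welcome (low priority) · by planner
why it might fail: as for ChiralDescent: descending the ℂℙ²-stable oriented mirror equivalence to Σ ≅ −Σ is a definite cancellation problem; a chiral ℂℙ²-rigid exotic Σ refutes it.
sources: Wall1964 doi:10.1112/jlms/s1-39.1.131, GluckTAMS1962 §8, Gordon1976 doi:10.1007/BF02568175, arXiv:1910.08195 Q9.12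
BA — BI-DISSOLVABLE ⟹ AMPHICHIRAL (NEW, gen 5, support / attack line for ChiralDescent; in-cone via
the ChiralDescent skeleton ChiralDescent_of : BA → ChiralDescent, kernel
Amph5.chiralDescent_of_biDissolvableAmphichiral): a smooth homotopy 4-sphere that dissolves in BOTH
chiralities at positive rank (the hypothesis of BiDefiniteDescent verbatim) admits, for every
orientation oM, a self-diffeomorphism carrying oM to −oM. S-implied (kernel
Amph5.biDissolvableAmphichiral_of_spc4), ⟸ R #24778 (kernel), ⟸ Amphichiral (kernel); decided TRUE
on Φ4 (doubles, swap) and ⟺ GluckTwistsAmphichiral on Φ2 (kernel →, mod the Φ2 tree facts).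
Alternative cone: closesBA : E → CU → X₁ → BA → DDA → S (kernel, exact:
smoothPoincare4_iff_baCarving). [critic decomp-sp4-crit-1 g2, CLEARED 2026-08-30T05:37:14Z
(HOME/STATUS.md line 235) as route EDIT W2 of N (writer = opener) + W3 add BA: BA NEW support r9
(W3) · the ATTACK LINE of ChiralDescent («dissolves in BOTH chiralities ⟹ amphichiral»; BA → DDC by
vacuity, kernel chiralDescent_of_biDissolvableAmphichiral) · S-implied
(biDissolvableAmphichiral_of_spc4, via S⁴ reflection
sphereReflection_isOrientationReversing_of_ne_zero + orientation dichotomy) · GENU -/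
@[route_item "route-SmoothPoincare4-RootDecompN"]
def BiDissolvableAmphichiral : Prop :=
  open scoped ContDiff in ∀ (M : Type) [TopologicalSpace M] [T2Space M] [SecondCountableTopology M] [ChartedSpace (EuclideanSpace ℝ (Fin 4)) M] [IsManifold (𝓡 4) ∞ M], Nonempty (ContinuousMap.HomotopyEquiv M (Metric.sphere (0 : EuclideanSpace ℝ (Fin 5)) 1)) → (∀ (oM : Literature.Topology.FourManifolds.SmoothOrientation (𝓡 4) M) (c₀ : Literature.Topology.FourManifolds.SmoothOrientation (𝓡 4) Literature.Topology.FourManifolds.ComplexProjectivePlane), ∃ (n : ℕ) (P Q : ℕ → Type) (_ : ∀ i, TopologicalSpace (P i)) (_ : ∀ i, T2Space (P i)) (_ : ∀ i, SecondCountableTopology (P i)) (_ : ∀ i, ChartedSpace (EuclideanSpace ℝ (Fin 4)) (P i)) (_ : ∀ i, IsManifold (𝓡 4) ∞ (P i)) (_ : ∀ i, CompactSpace (P i)) (_ : ∀ i, TopologicalSpace (Q i)) (_ : ∀ i, T2Space (Q i)) (_ : ∀ i, SecondCountableTopology (Q i)) (_ : ∀ i, ChartedSpace (EuclideanSpace ℝ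 (Fin 4)) (Q i)) (_ : ∀ i, IsManifold (𝓡 4) ∞ (Q i)) (_ : ∀ i, CompactSpace (Q i)) (o : ∀ i, Literature.Topology.FourManifolds.SmoothOrientation (𝓡 4) (P i)), 0 < n ∧ (∃ e : P 0 ≃ₘ⟮𝓡 4, 𝓡 4⟯ M, e.IsOrientationPreserving (o 0) oM) ∧ Nonempty (Q 0 ≃ₘ⟮𝓡 4, 𝓡 4⟯ (Metric.sphere (0 : EuclideanSpace ℝ (Fin 5)) 1)) ∧ (∀ i < n, Literature.Topology.FourManifolds.IsOrientedConnectedSum (o i) c₀ (o (i + 1))) ∧ (∀ i < n, Literature.Topology.FourManifolds.IsConnectedSum (𝓡 4) (𝓡 4) (𝓡 4) (Q i) Literature.Topology.FourManifolds.ComplexProjectivePlane (Q (i + 1))) ∧ Nonempty (P n ≃ₘ⟮𝓡 4, 𝓡 4⟯ Q n)) → ∀ (oM : Literature.Topology.FourManifolds.SmoothOrientation (𝓡 4) M), ∃ ρ : M ≃ₘ⟮𝓡 4, 𝓡 4⟯ M, ρ.IsOrientationPreserving oM (-oM)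

-- parent: BiDissolvableAmphichiral · child (gen 1)
/--     item stmt-SmoothPoincare4-29362 · crux · rank 902 · open
    parent: BiDissolvableAmphichiral · by planner
    why it might fail: descent of a diffeomorphism through ℂℙ² summands fails in general (exotic diffeomorphisms of #nℂℙ² survive one stabilisation: Lin 2020, Konno–Mallick–Taniguchi); a chiral exotic Σ that is bi-dissolvable (e.g. a Gluck twist Σ_K ≇ Σ_{mK}) refutes it.
    sources: Wall1964 doi:10.1112/jlms/s1-39.1.131, KervaireMilnorAnnals1963 Lemma 2.1, Gordon1976 doi:10.1007/BF02568175, AitchisonRubinstein1984 in doi:10.1090/conm/035 (pp. 1–74), arXiv:1910.08195 Q9.12, Gabai LBT arXiv:1705.09989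
SMD — STABLE MIRROR DESCENT (NEW, gen 6, the ATTACKED child; lens-6 (A,B)-carving with B KNOWN): if
a smooth homotopy 4-sphere M is ℂℙ²-STABLY MIRROR SYMMETRIC — for some orientation oM, chirality c₀
and length n, the oriented blow-up chain (M, oM) # n(ℂℙ², c₀) is orientation-PRESERVINGLY
diffeomorphic to the chain (M, −oM) # n(ℂℙ², c₀) built from the MIRROR of M with the SAME summands
(MirrorSymmetricAt M oM c₀ n: chains P from (M,oM) and P' from (M,−oM), every step an
IsOrientedConnectedSum with (ℂℙ², c₀), and d : P n ≃ P' n preserving (o n, o' n)) — then M is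
AMPHICHIRAL (every orientation is reversed by a self-diffeomorphism). Reading: ℂℙ²-CANCELLATION FOR
THE PAIR (Σ, Σ̄) — the registered cancellation pieces X₁ #17708 / CP2Cancellation compare Σ with S⁴;
SMD compares Σ with its mirror and concludes only chirality, not standardness. KERNEL: S ⟹ SMD
(stableMirrorDescent_of_spc4); Amphichiral ⟹ SMD; Pin ∧ SMD ⟹ BA #28679 ⟹ DDC #28676
(biDissolvableAmphichiral_of_pin_smd, chiralDescent_of_pin_smd); length 0 is trivial
(isOrientationReversing_of_mirrorSymmetricAt_zero); four-sign symmetry. DECIDED TRUE (conclusion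
holds) where S is OPEN: Φ1 Cappell–Shaneson spheres (orientation-rev -/
@[route_item "route-SmoothPoincare4-RootDecompN"]
def StableMirrorDescent : Prop :=
  open scoped ContDiff in ∀ (M : Type) [TopologicalSpace M] [T2Space M] [SecondCountableTopology M] [ChartedSpace (EuclideanSpace ℝ (Fin 4)) M] [IsManifold (𝓡 4) ∞ M], Nonempty (ContinuousMap.HomotopyEquiv M (Metric.sphere (0 : EuclideanSpace ℝ (Fin 5)) 1)) → ∀ (oM : Literature.Topology.FourManifolds.SmoothOrientation (𝓡 4) M) (c₀ : Literature.Topology.FourManifolds.SmoothOrientation (𝓡 4) Literature.Topology.FourManifolds.ComplexProjectivePlane) (n : ℕ), (∃ (P P' : ℕ → Type) (_ : ∀ i, TopologicalSpace (P i)) (_ : ∀ i, T2Space (P i)) (_ : ∀ i, SecondCountableTopology (P i)) (_ : ∀ i, ChartedSpace (EuclideanSpace ℝ (Fin 4)) (P i)) (_ : ∀ i, IsManifold (𝓡 4) ∞ (P i)) (_ : ∀ i, CompactSpace (P i)) (_ : ∀ i, TopologicalSpace (P' i)) (_ : ∀ i, T2Space (P' i)) (_ : ∀ i, SecondCountableTopology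 (P' i)) (_ : ∀ i, ChartedSpace (EuclideanSpace ℝ (Fin 4)) (P' i)) (_ : ∀ i, IsManifold (𝓡 4) ∞ (P' i)) (_ : ∀ i, CompactSpace (P' i)) (o : ∀ i, Literature.Topology.FourManifolds.SmoothOrientation (𝓡 4) (P i)) (o' : ∀ i, Literature.Topology.FourManifolds.SmoothOrientation (𝓡 4) (P' i)), (∃ e : P 0 ≃ₘ⟮𝓡 4, 𝓡 4⟯ M, e.IsOrientationPreserving (o 0) oM) ∧ (∃ e' : P' 0 ≃ₘ⟮𝓡 4, 𝓡 4⟯ M, e'.IsOrientationPreserving (o' 0) (-oM)) ∧ (∀ i < n, Literature.Topology.FourManifolds.IsOrientedConnectedSum (o i) c₀ (o (i + 1))) ∧ (∀ i < n, Literature.Topology.FourManifolds.IsOrientedConnectedSum (o' i) c₀ (o' (i + 1))) ∧ ∃ d : P n ≃ₘ⟮𝓡 4, 𝓡 4⟯ P' n, d.IsOrientationPreserving (o n) (o' n)) → ∀ (oM' : Literature.Topology.FourManifolds.SmoothOrientation (𝓡 4) M), ∃ ρ : M ≃ₘ⟮𝓡 4, 𝓡 4⟯ M, ρ.IsOrientationPreserving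 oM' (-oM')

-- parent: BiDissolvableAmphichiral · child (gen 1)
/--     item stmt-SmoothPoincare4-29361 · support · rank 901 · open
    parent: BiDissolvableAmphichiral · by planner
    why it might fail: it cannot fail mathematically (classical); the typed form could only fail by a typing slip in the chain bookkeeping (guarded: S ⟹ Pin and Pin ∧ SMD ⟹ BA both elaborate in kernel).
    sources: KervaireMilnorAnnals1963 Lemma 2.1, Kosinski1993 VI.(1.1), MilnorHusemoller1973 (odd definite unimodular forms of rank n ≤ 8 are diagonal; only |σ| is used here), tree: Literature.Topology.FourManifolds.IsOrientedConnectedSum.signature_eq_add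
Pin — CHIRALITY PINNING (NEW, gen 6, SUPPORT · THEOREM · provable now): if a smooth homotopy
4-sphere M dissolves in BOTH chiralities at positive rank (the hypothesis of
BiDissolvableAmphichiral #28679 / BiDefiniteDescent #28145 VERBATIM: for every (oM, c₀) a blow-up
chain from (M, oM) with summands (ℂℙ², c₀), an orientation-FREE chain from S⁴ and an UNORIENTED
diffeomorphism of the ends), then for every chirality c₀ there is ONE length n > 0 such that for
EVERY orientation oM a PINNED chain exists: oriented chain P from (M, oM) with summands (ℂℙ², c₀),
ORIENTED standard chain Q from S⁴ with the same summands, and an orientation-PRESERVING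
diffeomorphism (P n, o n) ≅⁺ (Q n, oQ n). Paper proof (homology bookkeeping): (P n, o n) has
intersection form n⟨ε⟩ (ε = ±1 the sign of c₀; signature additivity, tree
IsOrientedConnectedSum.signature_eq_add, σ(ℂℙ², c₀) = ε); the orientation-free chain Q n is #a(ℂℙ²,
c₀) # b(ℂℙ², −c₀) with a + b = n (orient each step, Kervaire–Milnor uniqueness/commutativity); P n ≅
Q n forces |σ(Q n)| = n, so b = 0 or a = 0, and the diffeomorphism to #n(ℂℙ², ±c₀) is
orientation-preserving towards exactly one of the two pinned standard chains (an orientation-rever -/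
@[route_item "route-SmoothPoincare4-RootDecompN"]
def ChiralityPinning : Prop :=
  open scoped ContDiff in ∀ (M : Type) [TopologicalSpace M] [T2Space M] [SecondCountableTopology M] [ChartedSpace (EuclideanSpace ℝ (Fin 4)) M] [IsManifold (𝓡 4) ∞ M], Nonempty (ContinuousMap.HomotopyEquiv M (Metric.sphere (0 : EuclideanSpace ℝ (Fin 5)) 1)) → (∀ (oM : Literature.Topology.FourManifolds.SmoothOrientation (𝓡 4) M) (c₀ : Literature.Topology.FourManifolds.SmoothOrientation (𝓡 4) Literature.Topology.FourManifolds.ComplexProjectivePlane), ∃ (n : ℕ) (P Q : ℕ → Type) (_ : ∀ i, TopologicalSpace (P i)) (_ : ∀ i, T2Space (P i)) (_ : ∀ i, SecondCountableTopology (P i)) (_ : ∀ i, ChartedSpace (EuclideanSpace ℝ (Fin 4)) (P i)) (_ : ∀ i, IsManifold (𝓡 4) ∞ (P i)) (_ : ∀ i, CompactSpace (P i)) (_ : ∀ i, TopologicalSpace (Q i)) (_ : ∀ i, T2Space (Q i)) (_ : ∀ i, SecondCountableTopology (Q i)) (_ : ∀ i, ChartedSpace (EuclideanSpace ℝ (Fin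 4)) (Q i)) (_ : ∀ i, IsManifold (𝓡 4) ∞ (Q i)) (_ : ∀ i, CompactSpace (Q i)) (o : ∀ i, Literature.Topology.FourManifolds.SmoothOrientation (𝓡 4) (P i)), 0 < n ∧ (∃ e : P 0 ≃ₘ⟮𝓡 4, 𝓡 4⟯ M, e.IsOrientationPreserving (o 0) oM) ∧ Nonempty (Q 0 ≃ₘ⟮𝓡 4, 𝓡 4⟯ (Metric.sphere (0 : EuclideanSpace ℝ (Fin 5)) 1)) ∧ (∀ i < n, Literature.Topology.FourManifolds.IsOrientedConnectedSum (o i) c₀ (o (i + 1))) ∧ (∀ i < n, Literature.Topology.FourManifolds.IsConnectedSum (𝓡 4) (𝓡 4) (𝓡 4) (Q i) Literature.Topology.FourManifolds.ComplexProjectivePlane (Q (i + 1))) ∧ Nonempty (P n ≃ₘ⟮𝓡 4, 𝓡 4⟯ Q n)) → ∀ (c₀ : Literature.Topology.FourManifolds.SmoothOrientation (𝓡 4) Literature.Topology.FourManifolds.ComplexProjectivePlane), ∃ n : ℕ, 0 < n ∧ ∀ (oM : Literature.Topology.FourManifolds.SmoothOrientation (𝓡 4) M), ∃ (P Q : ℕ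 → Type) (_ : ∀ i, TopologicalSpace (P i)) (_ : ∀ i, T2Space (P i)) (_ : ∀ i, SecondCountableTopology (P i)) (_ : ∀ i, ChartedSpace (EuclideanSpace ℝ (Fin 4)) (P i)) (_ : ∀ i, IsManifold (𝓡 4) ∞ (P i)) (_ : ∀ i, CompactSpace (P i)) (_ : ∀ i, TopologicalSpace (Q i)) (_ : ∀ i, T2Space (Q i)) (_ : ∀ i, SecondCountableTopology (Q i)) (_ : ∀ i, ChartedSpace (EuclideanSpace ℝ (Fin 4)) (Q i)) (_ : ∀ i, IsManifold (𝓡 4) ∞ (Q i)) (_ : ∀ i, CompactSpace (Q i)) (o : ∀ i, Literature.Topology.FourManifolds.SmoothOrientation (𝓡 4) (P i)) (oQ : ∀ i, Literature.Topology.FourManifolds.SmoothOrientation (𝓡 4) (Q i)), (∃ e : P 0 ≃ₘ⟮𝓡 4, 𝓡 4⟯ M, e.IsOrientationPreserving (o 0) oM) ∧ Nonempty (Q 0 ≃ₘ⟮𝓡 4, 𝓡 4⟯ (Metric.sphere (0 : EuclideanSpace ℝ (Fin 5)) 1)) ∧ (∀ i < n, Literature.Topology.FourManifolds.IsOrientedConnectedSum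 (o i) c₀ (o (i + 1))) ∧ (∀ i < n, Literature.Topology.FourManifolds.IsOrientedConnectedSum (oQ i) c₀ (oQ (i + 1))) ∧ ∃ d : P n ≃ₘ⟮𝓡 4, 𝓡 4⟯ Q n, d.IsOrientationPreserving (o n) (oQ n)

-- parent: BiDissolvableAmphichiral · glue (gen 1)
/--     item stmt-SmoothPoincare4-29363 · support · rank 903 · closed · proved by Summit.SmoothPoincare4.SmoothPoincare4.Theorems.RootDecompNBiDissolvableAmphichiralMirrorSplit.biDissolvableAmphichiralMirrorGlue_holds (prover)
    parent: BiDissolvableAmphichiral · GLUE: children ⟹ parent · by planner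
ChiralityPinning → StableMirrorDescent → BiDissolvableAmphichiral -/
@[route_item "route-SmoothPoincare4-RootDecompN"]
def BiDissolvableAmphichiralMirrorGlue : Prop :=
  ChiralityPinning → StableMirrorDescent → BiDissolvableAmphichiral

-- `BiDissolvableAmphichiralMirrorGlue` holds: proved by `Summit.SmoothPoincare4.SmoothPoincare4.Theorems.RootDecompNBiDissolvableAmphichiralMirrorSplit.biDissolvableAmphichiralMirrorGlue_holds` (its module imports this route file, so no `_holds` link can be stated here).

/-- item stmt-SmoothPoincare4-28146 · assembly · rank 1 · open · by planner
sources: arXiv:1910.08195, doi:10.1016/0040-9383(91)90036-4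
[assembly] DefiniteDissolution → ChiralUpgrade → CP2CancellationOne → BiDefiniteDescent →
SmoothPoincare4 (all four binders load-bearing; lens probes P7/P8). -/
@[route_item "route-SmoothPoincare4-RootDecompN"]
def Assembly : Prop :=
  DefiniteDissolution → ChiralUpgrade → CP2CancellationOne → BiDefiniteDescent → SmoothPoincare4

/-! D-0027 §2.1 — DECIDING THEOREM (planner-authored via `route open/edit --closes-file`; by planner-decomp-sp4-writer-1-g2-0 2026-08-30T04:53:34Z):
its hypotheses are this route's items and its conclusion the sub-problem Statement (glue_lint), and it elaborates with this file. -/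

@[closes "route-SmoothPoincare4-RootDecompN"] theorem closes (h₁ : DefiniteDissolution) (h₂ : ChiralUpgrade) (h₃ : CP2CancellationOne)
    (h₄ : BiDefiniteDescent) : SmoothPoincare4 := by
  intro M _ _ _ _ _ e
  by_contra hM
  obtain ⟨n, P, Q, _, _, _, _, _, _, _, _, _, _, _, _, o, c, h0, h1, h2, h3, h4, h5⟩ := h₁ M ⟨e⟩
  have hall := h₂ M ⟨e⟩ n P Q o c h0 h1 h2 h3 h4 h5
  refine hM (h₃ M e (h₄ M ⟨e⟩ fun oM c₀ => ?_))
  obtain ⟨m, P', Q', a1, a2, a3, a4, a5, a6, b1, b2, b3, b4, b5, b6, o', he, g1, g2, g3, g4⟩ :=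
    hall oM c₀
  refine ⟨m, P', Q', a1, a2, a3, a4, a5, a6, b1, b2, b3, b4, b5, b6, o', ?_, he, g1, g2, g3, g4⟩
  rcases Nat.eq_zero_or_pos m with hm | hm
  · subst hm
    obtain ⟨e0, -⟩ := he
    obtain ⟨q0⟩ := g1
    obtain ⟨d⟩ := g4
    exact (hM ⟨e0.symm.trans (d.trans q0)⟩).elim
  · exact hm

end Summit.SmoothPoincare4.SmoothPoincare4.Theses.RootDecompN
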